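import Literature.Analysis.Pluripotential.PshLocalIntegrability
import Literature.Analysis.Pluripotential.RegularLocusLeviForm
import Literature.Analysis.Pluripotential.FubiniStudyLeviMatrix
import HarnessLib

/-!
# The chart potential of a closed positive `(1,1)`-current on `ℙᴺ`: integrability and growth

Topic `Literature/Analysis/Pluripotential`; step (P3, continued) of the proof of
`BoucksomEtAl2010_regularMass_le_degree_pow` (`NonPluripolarMongeAmpereMass.lean`). For
`T : ClosedPositiveOneOneCurrent N` with cone potential `V` (psh on `ℂ^{N+1} ∖ 0`, log-homogeneous
of degree `c = deg T`) and real chart potential `g = T.chartPotential = (V ∘ chartVec).toReal`: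

* `isPlurisubharmonicOn_pot_chartVec` — `w ↦ V(1, w)` is psh on all of `ℂᴺ`;
  `isSubharmonicOn_pot_chartVec_line`; `exists_pot_chartVec_ne_bot` (some chart point is not a
  pole, by homogeneity and `frequently_ne_bot`); `exists_forall_pot_chartVec_le` (bounded above
  on compacts);
* `exists_chartPotential_le` — **growth** `g ≤ c · fsPotential + C₀` with `C₀ ≥ 0`
  (`V ≤ C_S + c log ‖z‖_∞`, `C_S = max_{‖z‖_∞ = 1} V`, and `log ‖(1,w)‖_∞ ≤ ½log(1+|w|²)`);
* `chartPotential_le_circleAverage_of_ne_bot` — **mean-value inequality at every non-pole**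
  (all directions, all radii) with circle integrability;
* `lintegral_closedBall_negPart_pot_chartVec_lt_top`, `integrableOn_chartPotential_closedBall`,
  `locallyIntegrable_chartPotential` — **`g ∈ L¹_{loc}(ℂᴺ)`** (polydisc inequality around a
  non-pole); `ae_pot_chartVec_ne_bot` — **poles are Lebesgue-null**.

## References

* [HormanderSCV1973] L. Hörmander, An introduction to complex analysis in several variables
  (1973), Thm. 1.6.3, Def. 2.6.1, §2.6.
-/

noncomputable section

open scoped Topology ENNReal
open MeasureTheory Filter Set Metric

namespace Literature.Analysis.Pluripotential

/-! ### Consequences for the chart potential of a closed positive `(1,1)`-current on `ℙᴺ` -/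

section Chart

open Literature.AlgebraicGeometry.HodgeTheory.BiextensionHeight (chartVec fsPotential)

variable {N : ℕ} (T : ClosedPositiveOneOneCurrent N)

namespace ClosedPositiveOneOneCurrent

/-- The cone potential read in the affine chart, `w ↦ V(1, w)`, is plurisubharmonic on all of
`ℂᴺ` (the chart avoids the vertex; lines of the chart are lines of `ℂ^{N+1} ∖ {0}`).
[cite: HormanderSCV1973, Def. 2.6.1] -/
theorem isPlurisubharmonicOn_pot_chartVec :
    IsPlurisubharmonicOn (fun w : Fin N → ℂ ↦ T.pot (chartVec w)) univ := by
  have hps := T.isPlurisubharmonicOn_pot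
  refine ⟨?_, fun w _ ↦ T.pot_lt_top (chartVec_ne_zero w), fun w ξ ↦ ?_⟩
  · exact hps.upperSemicontinuousOn.comp contDiff_chartVec.continuous.continuousOn
      fun w _ ↦ chartVec_ne_zero w
  · have h := hps.isSubharmonicOn_line (chartVec w) (Fin.insertNth 0 (0 : ℂ) ξ)
    have hset : {τ : ℂ | chartVec w + τ • Fin.insertNth 0 (0 : ℂ) ξ ∈ ({0}ᶜ : Set (Fin (N + 1) →
        ℂ))}
        = univ := by
      refine eq_univ_of_forall fun τ ↦ ?_
      rw [mem_setOf_eq, ← chartVec_add_smul]; exact chartVec_ne_zero _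
    rw [hset] at h
    simp only [← chartVec_add_smul] at h
    simpa using h

/-- There is a chart point which is not a pole of the cone potential. [folklore] -/
theorem exists_pot_chartVec_ne_bot : ∃ w₀ : Fin N → ℂ, T.pot (chartVec w₀) ≠ ⊥ := by
  by_contra h
  push Not at h
  have hall : ∀ᶠ y in 𝓝 (chartVec (0 : Fin N → ℂ)), T.pot y = ⊥ := by
    have hz0 : ∀ᶠ y in 𝓝 (chartVec (0 : Fin N → ℂ)), y 0 ≠ 0 :=
      (continuous_apply 0).continuousAt.eventually_ne (by simp [chartVec])
    filter_upwards [hz0] with y hy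
    rw [eq_smul_chartVec hy, T.pot_smul hy (chartVec_ne_zero _), h, EReal.bot_add]
  exact T.frequently_ne_bot (chartVec 0) (chartVec_ne_zero 0)
    (hall.mono fun y hy ↦ not_ne_iff.mpr hy)

/-- **The chart potential is bounded above by `c · fs + C₀`**: `V(1, w) ≤ C_S + c log ‖(1,w)‖_∞`
with `C_S` the maximum of the upper semicontinuous `V` on the unit sup-norm sphere, and
`log ‖(1, w)‖_∞ ≤ ½ log (1 + |w|²)`; at poles `g = 0 ≤ c fs + C₀` as `C₀ ≥ 0`. [folklore] -/
theorem exists_chartPotential_le : ∃ C₀ : ℝ, 0 ≤ C₀ ∧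
    ∀ w : Fin N → ℂ, T.chartPotential w ≤ T.degree * fsPotential w + C₀ := by
  -- maximum of `V` on the unit sphere
  have hS : IsCompact (sphere (0 : Fin (N + 1) → ℂ) 1) := isCompact_sphere 0 1
  have hSne : (sphere (0 : Fin (N + 1) → ℂ) 1).Nonempty := by
    refine ⟨chartVec 0, ?_⟩
    rw [mem_sphere_zero_iff_norm]
    refine le_antisymm ((pi_norm_le_iff_of_nonneg zero_le_one).2 fun i ↦ ?_) ?_
    · refine Fin.cases ?_ (fun j ↦ ?_) i <;> simp [chartVec]
    · simpa [chartVec] using norm_le_pi_norm (chartVec (0 : Fin N → ℂ)) 0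
  have hSsub : sphere (0 : Fin (N + 1) → ℂ) 1 ⊆ ({0}ᶜ : Set (Fin (N + 1) → ℂ)) := by
    intro z hz h0
    rw [mem_singleton_iff.mp h0, mem_sphere_zero_iff_norm, norm_zero] at hz
    exact zero_ne_one hz
  obtain ⟨z₁, hz₁, hmax⟩ := (T.isPlurisubharmonicOn_pot.upperSemicontinuousOn.mono
      hSsub).exists_isMaxOn
    hSne hS
  set CS : ℝ := (T.pot z₁).toReal with hCS
  have hCS' : ∀ z ∈ sphere (0 : Fin (N + 1) → ℂ) 1, T.pot z ≤ (CS : EReal) := fun z hz ↦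
    (hmax hz).trans (EReal.le_coe_toReal (T.pot_lt_top (hSsub hz₁)).ne)
  refine ⟨max CS 0, le_max_right _ _, fun w ↦ ?_⟩
  have hfs : 0 ≤ fsPotential w := by
    rw [fsPotential]; exact div_nonneg (Real.log_nonneg (by
      have : 0 ≤ ∑ p, ‖w p‖ ^ 2 := by positivity
      linarith)) zero_le_two
  by_cases hpole : T.pot (chartVec w) = ⊥
  · rw [show T.chartPotential w = (T.pot (chartVec w)).toReal from rfl, hpole]
    simp only [EReal.toReal_bot]
    nlinarith [T.degree_nonneg, le_max_right CS 0]
  · -- normalise `(1, w)` to the unit sphere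
    set z := chartVec w with hz
    have hz0 : z ≠ 0 := chartVec_ne_zero w
    have hnorm : 0 < ‖z‖ := norm_pos_iff.mpr hz0
    have hunit : (‖z‖⁻¹ : ℂ) • z ∈ sphere (0 : Fin (N + 1) → ℂ) 1 := by
      rw [mem_sphere_zero_iff_norm, norm_smul, norm_inv, Complex.norm_real, Real.norm_eq_abs,
        abs_of_pos hnorm, inv_mul_cancel₀ hnorm.ne']
    have hhom := T.pot_smul (a := (‖z‖⁻¹ : ℂ)) (by exact_mod_cast (inv_ne_zero hnorm.ne')) hz0
    have hle : T.pot ((‖z‖⁻¹ : ℂ) • z) ≤ (CS : EReal) := hCS' _ hunit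
    rw [hhom, norm_inv, Complex.norm_real, Real.norm_eq_abs, abs_of_pos hnorm,
      Real.log_inv] at hle
    -- `V z ≤ CS + c log ‖z‖`
    have hV : T.pot z ≤ ((CS + T.degree * Real.log ‖z‖ : ℝ) : EReal) := by
      have hfin : T.pot z = ((T.pot z).toReal : EReal) :=
        (EReal.coe_toReal (T.pot_lt_top hz0).ne hpole).symm
      rw [hfin, ← EReal.coe_add, EReal.coe_le_coe_iff] at hle
      rw [hfin, EReal.coe_le_coe_iff]
      linarith
    -- `log ‖(1, w)‖_∞ ≤ fs w`
    have hlog : Real.log ‖z‖ ≤ fsPotential w := by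
      rw [fsPotential, le_div_iff₀ two_pos, mul_comm, ← Real.log_rpow hnorm, Real.rpow_two]
      refine Real.log_le_log (by positivity) ?_
      -- `‖(1,w)‖_∞² ≤ 1 + Σ |w_p|²`
      have h1 : ‖z‖ ≤ max 1 ‖w‖ := by
        refine (pi_norm_le_iff_of_nonneg (by positivity)).2 fun i ↦ ?_
        refine Fin.cases ?_ (fun j ↦ ?_) i
        · simp [hz, chartVec]
        · simpa [hz, chartVec] using (norm_le_pi_norm w j).trans (le_max_right 1 ‖w‖)
      have h2 : ‖w‖ ^ 2 ≤ ∑ p, ‖w p‖ ^ 2 := by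
        rcases (Finset.univ : Finset (Fin N)).eq_empty_or_nonempty with hN | hN
        · have : ‖w‖ = 0 := by
            refine le_antisymm ((pi_norm_le_iff_of_nonneg le_rfl).mpr fun i ↦ ?_) (norm_nonneg _)
            exact absurd (Finset.mem_univ i) (by simp [hN])
          simp [this, hN]
        · obtain ⟨k, -, hk⟩ := Finset.exists_max_image Finset.univ (fun i ↦ ‖w i‖) hN
          have hwk : ‖w‖ = ‖w k‖ := le_antisymm ((pi_norm_le_iff_of_nonneg (norm_nonneg _)).2
            fun i ↦ hk i (Finset.mem_univ i)) (norm_le_pi_norm w k)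
          rw [hwk]
          exact Finset.single_le_sum (f := fun p ↦ ‖w p‖ ^ 2) (fun i _ ↦ by positivity)
            (Finset.mem_univ k)
      calc ‖z‖ ^ 2 ≤ (max 1 ‖w‖) ^ 2 := by gcongr
        _ ≤ 1 + ∑ p, ‖w p‖ ^ 2 := by
            rcases le_total 1 ‖w‖ with h | h
            · rw [max_eq_right h]; linarith
            · rw [max_eq_left h]; have : 0 ≤ ∑ p, ‖w p‖ ^ 2 := by positivity
              linarith
    have hreal : T.chartPotential w = (T.pot z).toReal := rfl
    rw [hreal]
    have := EReal.toReal_le_toReal hV (by rw [hz]; exact hpole) (EReal.coe_ne_top _)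
    rw [EReal.toReal_coe] at this
    calc (T.pot z).toReal ≤ CS + T.degree * Real.log ‖z‖ := this
      _ ≤ T.degree * fsPotential w + max CS 0 := by
          nlinarith [mul_le_mul_of_nonneg_left hlog T.degree_nonneg, le_max_left CS 0]


/-- The chart potential in a complex line of the chart, as a subharmonic function on `ℂ`.
[cite: HormanderSCV1973, Def. 2.6.1] -/
theorem isSubharmonicOn_pot_chartVec_line (w ξ : Fin N → ℂ) :
    IsSubharmonicOn (fun τ : ℂ ↦ T.pot (chartVec (w + τ • ξ))) univ := by
  have h := T.isPlurisubharmonicOn_pot_chartVec.isSubharmonicOn_line w ξ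
  simpa using h

/-- **Mean-value inequality for the chart potential at a non-pole**: if `V(1, w) ≠ -∞` then for
every direction `ξ` and radius `r > 0` the real chart potential `g` (junk `0` at poles) is
integrable on the circle `w + r e^{iθ} ξ` and `g(w) ≤ (2π)⁻¹ ∫₀^{2π} g(w + r e^{iθ} ξ) dθ`.
[cite: HormanderSCV1973, Thm. 1.6.3] -/
theorem chartPotential_le_circleAverage_of_ne_bot {w : Fin N → ℂ} (hw : T.pot (chartVec w) ≠ ⊥)
    (ξ : Fin N → ℂ) {r : ℝ} (hr : 0 < r) :
    CircleIntegrable (fun τ : ℂ ↦ T.chartPotential (w + τ • ξ)) 0 r ∧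
      T.chartPotential w ≤ Real.circleAverage (fun τ : ℂ ↦ T.chartPotential (w + τ • ξ)) 0 r := by
  have h := (T.isSubharmonicOn_pot_chartVec_line w ξ).circleIntegrable_toReal (c := 0) hr
    (subset_univ _) (by simpa using hw)
  simpa [chartPotential] using h

/-- The chart potential is bounded above on every compact set by a real constant (upper
semicontinuity of `V`). [folklore] -/
theorem exists_forall_pot_chartVec_le {K : Set (Fin N → ℂ)} (hK : IsCompact K) (hne : K.Nonempty) :
    ∃ M : ℝ, ∀ w ∈ K, T.pot (chartVec w) ≤ M := by
  obtain ⟨w₁, hw₁, hmax⟩ :=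
    (T.isPlurisubharmonicOn_pot_chartVec.upperSemicontinuousOn.mono (subset_univ K)).exists_isMaxOn
      hne hK
  exact ⟨(T.pot (chartVec w₁)).toReal, fun w hw ↦
    (hmax hw).trans (EReal.le_coe_toReal (T.pot_lt_top (chartVec_ne_zero w₁)).ne)⟩

/-- **Local integrability of the chart potential** and finiteness of the polar mass on balls
around a non-pole: for every `ρ > 0`, `∫_{P̄(w₀, ρ)} V(1,·)⁻ < ∞`. [cite: HormanderSCV1973,
    Thm. 1.6.3 (proof), §2.6] -/
theorem lintegral_closedBall_negPart_pot_chartVec_lt_top {w₀ : Fin N → ℂ}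
    (hw₀ : T.pot (chartVec w₀) ≠ ⊥) {ρ : ℝ} (hρ : 0 < ρ) :
    ∫⁻ w in closedBall w₀ ρ, (-T.pot (chartVec w)).toENNReal < ⊤ := by
  obtain ⟨M, hM⟩ := T.exists_forall_pot_chartVec_le (isCompact_closedBall w₀ ρ)
    ⟨w₀, mem_closedBall_self hρ.le⟩
  refine lt_of_le_of_lt (IsPlurisubharmonicOn.lintegral_closedBall_negPart_le_pi N _
    T.isPlurisubharmonicOn_pot_chartVec w₀ hρ hM) ?_
  refine ENNReal.mul_lt_top (ENNReal.add_lt_top.mpr ⟨?_, ?_⟩) ?_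
  · exact ENNReal.mul_lt_top (ENNReal.natCast_lt_top N) ENNReal.ofReal_lt_top
  · rcases EReal.eq_bot_or_eq_top_or_exists_coe (T.pot (chartVec w₀)) with h | h | ⟨x, h⟩
    · exact absurd h hw₀
    · exact absurd h (T.pot_lt_top (chartVec_ne_zero w₀)).ne
    · rw [h, ← EReal.coe_neg, EReal.real_coe_toENNReal]; exact ENNReal.ofReal_lt_top
  · exact (isCompact_closedBall w₀ ρ).measure_lt_top

/-- The chart potential is integrable on every closed ball centred at a non-pole. [folklore] -/
theorem integrableOn_chartPotential_closedBall {w₀ : Fin N → ℂ} (hw₀ : T.pot (chartVec w₀) ≠ ⊥)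
    {ρ : ℝ} (hρ : 0 < ρ) : IntegrableOn T.chartPotential (closedBall w₀ ρ) := by
  have hmeas : Measurable fun w : Fin N → ℂ ↦ T.pot (chartVec w) :=
    T.isPlurisubharmonicOn_pot_chartVec.measurable_of_univ
  obtain ⟨M, hM⟩ := T.exists_forall_pot_chartVec_le (isCompact_closedBall w₀ ρ)
    ⟨w₀, mem_closedBall_self hρ.le⟩
  refine ⟨(hmeas.ereal_toReal).aestronglyMeasurable, ?_⟩
  refine lt_of_le_of_lt (lintegral_mono fun w ↦ enorm_toReal_le _) ?_
  rw [lintegral_add_left hmeas.ereal_toENNReal]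
  refine ENNReal.add_lt_top.mpr ⟨?_, T.lintegral_closedBall_negPart_pot_chartVec_lt_top hw₀ hρ⟩
  calc ∫⁻ w in closedBall w₀ ρ, (T.pot (chartVec w)).toENNReal
      ≤ ∫⁻ _ in closedBall w₀ ρ, ENNReal.ofReal M := by
        refine setLIntegral_mono' measurableSet_closedBall fun w hw ↦ ?_
        calc (T.pot (chartVec w)).toENNReal ≤ ((M : ℝ) : EReal).toENNReal :=
              EReal.toENNReal_le_toENNReal (hM w hw)
          _ = ENNReal.ofReal M := EReal.real_coe_toENNReal M
    _ < ⊤ := by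
        rw [setLIntegral_const]
        exact ENNReal.mul_lt_top ENNReal.ofReal_lt_top (isCompact_closedBall w₀ ρ).measure_lt_top

/-- **The chart potential of a closed positive `(1,1)`-current is locally integrable on the chart.**
[cite: HormanderSCV1973, §2.6 (psh functions are `L¹_{loc}`)] -/
theorem locallyIntegrable_chartPotential : LocallyIntegrable T.chartPotential volume := by
  obtain ⟨w₀, hw₀⟩ := T.exists_pot_chartVec_ne_bot
  intro w
  refine ⟨closedBall w₀ (dist w w₀ + 1), ?_,
      T.integrableOn_chartPotential_closedBall hw₀ (by positivity)⟩
  refine Metric.mem_nhds_iff.mpr ⟨1, one_pos, fun y hy ↦ ?_⟩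
  rw [mem_closedBall]
  calc dist y w₀ ≤ dist y w + dist w w₀ := dist_triangle _ _ _
    _ ≤ dist w w₀ + 1 := by rw [mem_ball] at hy; linarith

/-- **Poles are Lebesgue-null**: `V(1, w) ≠ -∞` for almost every chart point `w`. [folklore] -/
theorem ae_pot_chartVec_ne_bot : ∀ᵐ w : Fin N → ℂ, T.pot (chartVec w) ≠ ⊥ := by
  obtain ⟨w₀, hw₀⟩ := T.exists_pot_chartVec_ne_bot
  have hmeas : Measurable fun w : Fin N → ℂ ↦ (-T.pot (chartVec w)).toENNReal :=
    T.isPlurisubharmonicOn_pot_chartVec.measurable_of_univ.neg.ereal_toENNReal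
  have hball : ∀ n : ℕ, ∀ᵐ w ∂(volume.restrict (closedBall w₀ (n + 1))),
      T.pot (chartVec w) ≠ ⊥ := by
    intro n
    have hlt := ae_lt_top' hmeas.aemeasurable
      (T.lintegral_closedBall_negPart_pot_chartVec_lt_top hw₀ (by positivity : (0 : ℝ) < n + 1)).ne
    filter_upwards [hlt] with w hw hbot
    rw [hbot] at hw
    simp at hw
  have huniv : (⋃ n : ℕ, closedBall w₀ ((n : ℝ) + 1)) = univ := by
    refine eq_univ_of_forall fun w ↦ mem_iUnion.mpr ⟨⌈dist w w₀⌉₊, ?_⟩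
    rw [mem_closedBall]
    exact (Nat.le_ceil _).trans (by linarith)
  have := (ae_restrict_iUnion_iff (μ := volume) (fun n : ℕ ↦ closedBall w₀ ((n : ℝ) + 1))
    (p := fun w ↦ T.pot (chartVec w) ≠ ⊥)).mpr hball
  rwa [huniv, Measure.restrict_univ] at this

end ClosedPositiveOneOneCurrent

end Chart

end Literature.Analysis.Pluripotential

end
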